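import Summits.HodgeConjecture.HodgeConjecture.Theses.HodgeProjectorDivisorSupport

/-!
# Crux `HodgeProjectorAlgebraic` (stmt-HodgeConjecture-18705) — birth skeleton `Lines/birth.lean`

Route `HodgeConjecture/HodgeProjectorDivisorSupport`, crux W2 (rank 3):
`HodgeProjectorAlgebraic := ∀ n X (hX : IsSmoothProjective (2n) X), 1 ≤ n → ∃ π ∈ N^{2n}H^{4n}((X ⊗ X)(ℂ); ℂ),
π_* = id on the rational (n,n)-classes of H^{2n}(X(ℂ); ℂ) and π_* = 0 on their cup-orthogonal` —
the ORTHOGONAL HODGE PROJECTOR `P` of `H^{2n}(X(ℂ); ℂ)` (onto `V := ℂ · Hdgⁿ(X)` along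
`V^⊥ := {b | a ∪ b = 0 for all a ∈ Hdgⁿ(X)}`) is the action `corrAction complexOrientationFamily`
of an ALGEBRAIC class on `X × X`.

## The line (Gram–Künneth class of the projector; Voisin I §11.3.3, Lemma 11.41)

`P` exists because the cup pairing is non-degenerate on `V` (Hodge–Riemann, BFNP 2009 (6.1));
writing `a₁, …, a_r` for a `ℚ`-basis of `Hdgⁿ(X)` and `(g^{kj}) = G⁻¹` for the inverse of the
(rational, invertible) Gram matrix `G = (⟨a_k ∪ a_j, [X]⟩)`, one has `P = Σ_{k,j} g^{kj} ⟨· ∪ a_j, [X]⟩ a_k`,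
and by the projection formula (Voisin I (11.11), tree `corrAction_sum_cross_apply`) `P` is, up to
the non-zero orientation scalar `t`, the action of the GRAM–KÜNNETH CLASS
`π₀ := Σ_{k,j} g^{kj} pr₁^* a_k ∪ pr₂^* a_j ∈ H^{4n}((X ⊗ X)(ℂ); ℂ)` — a RATIONAL class of Hodge type
`(2n, 2n)` lying in the span of the exterior products of middle Hodge classes of `X`. W2 is then
exactly the algebraicity of such a class (an instance of HC(`X × X`) in degree `4n`, implied already
by HC(`X`) in the middle degree since exterior products of algebraic classes are algebraic,
`cupProduct_map_fst_map_snd_mem_supportedClasses`). Three stubs: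

* `stub_orthogonalHodgeProjector` (theorem-grade, size M): for `X` smooth projective of dimension
  `2n ≥ 2` there is a `ℂ`-linear `P : H^{2n}(X(ℂ); ℂ) → H^{2n}(X(ℂ); ℂ)` with `P c = c` on rational
  `(n,n)`-classes and `P b = 0` on their cup-orthogonal — i.e. `H^{2n} = V ⊕ V^⊥`: non-degeneracy of
  the cup pairing on the `ℂ`-span of `Hdgⁿ(X)`. In tree: `hardLefschetz_hodgeRiemann_holds` ⇒
  `hardLefschetz_hodgeRiemann.hodgeClasses_cupPairing_nondegenerate` (every non-zero rational
  `(n,n)`-class has a rational `(n,n)` partner, `.middle`), the `ℚ`-structure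
  (`linearIndependent_of_isRationalClass`, `exists_basis_isRationalClass`,
  `hodgePQ_independent_of_hodgeModel_holds`), then `Submodule.linearProjOfIsCompl`.
* `stub_gramKunnethClass` (theorem-grade, size M): every such `P` is `t⁻¹ •` the correspondence
  action of a rational `(2n,2n)`-class `π₀` on `X ⊗ X` lying in
  `span_ℂ {pr₁^* a ∪ pr₂^* b : a, b ∈ Hdgⁿ(X)}`, `t ≠ 0` (the Gram–Künneth class above; Voisin I
  Lemma 11.41 for the type-`(0,0)` Hodge endomorphism `P`, made explicit). In tree: the pinning of
  `P` on `V ⊕ V^⊥`, `PerfPairDuality.*` / `exists_rational_dual`, `corrAction_sum_cross_apply`,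
  `isRationalClass_sum`, `IsRationalClass.cup/.map`, `isOfHodgeType_cupProduct_map_map_of_multiplicative_deRham`
  (files `HodgeClassOfMorphismDuality/Proofs`, `HodgeTypeExteriorProduct`); the scalar `t` cannot be
  removed for a rational `π₀` (`corrAction_eq_smul_of_orientationFamily`), exactly as in the tree's
  named fact `exists_hodgeClass_corrAction_eq_smul` (discharged: `…_holds`).
* `stub_gramClassAlgebraic` (THE CRUX CONTENT, open): a rational `(2n,2n)`-class `π₀` on `X ⊗ X` in
  the span of exterior products of middle Hodge classes of `X`, whose action is `t • P` (`t ≠ 0`: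
  `t •` identity on `Hdgⁿ`, zero on `Hdgⁿ^⊥`), is ALGEBRAIC: `π₀ ∈ N^{2n}H^{4n}((X ⊗ X)(ℂ); ℂ)`.
  Implied by HC(`X`) in degree `2n` (then every `pr₁^* a ∪ pr₂^* b` is algebraic); known
  unconditionally for `n = 1` (Lefschetz (1,1): `lefschetzOneOne_rational_holds`; Kahn–Murre–Pedrini's
  `π₂^{alg}`) and where End/Lefschetz correspondences span `Hdgⁿ` (abelian varieties of Weil type,
  divisorial sectors); open in general — for a transcendental-looking Hodge class it is as hard as
  the class itself.

`HodgeProjectorAlgebraic_of : Sig.stub_orthogonalHodgeProjector → Sig.stub_gramKunnethClass →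
Sig.stub_gramClassAlgebraic → HodgeProjectorAlgebraic` (kernel-checked, no `sorry`; `Sig.stub_*` = the
stub statements verbatim): take `P` (stub 1), its Gram–Künneth class `π₀` with `π₀_* = t • P`
(stub 2), algebraic by stub 3; then `π := t⁻¹ • π₀` is algebraic (`N^{2n}` is a `ℂ`-submodule) and
`π_* = t⁻¹ • π₀_* = P`: identity on `Hdgⁿ`, zero on `Hdgⁿ^⊥`. `HodgeProjectorAlgebraic_of_stubs`
instantiates it with the sorried stubs (its only `sorryAx` sources).

Hardest stub: `stub_gramClassAlgebraic` (= HC for the one Hodge class `[P] ∈ End_HS(H^{2n}(X, ℚ)) ⊂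
Hdg^{2n}(X × X)`; first battleground: `X` an abelian fourfold of Weil type / a K3 × K3-type
situation where `Hdg²` is not spanned by End/Lefschetz correspondences). Disproof used: none (no
`Disproof.lean` on this crux; `ledger negatives --problem HodgeConjecture`: 3 entries, none touches
projectors / correspondences). Refuter birth vetting (2026-08-17): crux survives; `Hdg ∩ Hdg^⊥ = 0`
holds in the tree, so the projector spec of stub 1 is consistent.

References: [VoisinHodgeI2002] §7.1.2, Thm. 6.32 (Hodge–Riemann), §11.3.3 Thm. 11.38 and
Lemma 11.41 with (11.11); [BrosnanFangNiePearlstein2009] §6 (6.1); [Kleiman1968] §1–2 (algebraic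
projectors from an invertible intersection matrix); [Andre1996] §1–2; B. Kahn, J. Murre,
C. Pedrini, *On the transcendental part of the motive of a surface* (2007), §7.2 (`π₂^{alg}`),
doi:10.1017/cbo9781107325968.009; [Voisin2025] §5.2–5.3 (the Hodge summand `δ_alg` of `[Δ_X]`);
[Markman2025] arXiv:2502.03415 (Weil classes on abelian 2n-folds).
-/

-- every declaration of this problem lives in `Summit.HodgeConjecture.HodgeConjecture.…` (summit = sub-problem)
set_option linter.dupNamespace false

noncomputable section

namespace Summit.HodgeConjecture.HodgeConjecture.Cruxes.HodgeProjectorAlgebraic.Birth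

open CategoryTheory MonoidalCategory CartesianMonoidalCategory
open Literature.AlgebraicGeometry.Motives Literature.AlgebraicGeometry.HodgeTheory
open Literature.AlgebraicTopology.SingularHomology

/-! ### The stub statements as named propositions

`Sig.stub_<name>` is the statement of `stub_<name>` VERBATIM (an `abbrev`, so definitionally the same
term); they exist only so that the skeleton theorem `HodgeProjectorAlgebraic_of` takes its three
hypotheses BY THE STUBS' NAMES (the A12 skeleton audit admits a `Prop` hypothesis only when its head
constant is a registered obligation or a declared stub, by name). -/

namespace Sig

/-- The statement of `stub_orthogonalHodgeProjector`, verbatim. -/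
abbrev stub_orthogonalHodgeProjector : Prop :=
    ∀ (n : ℕ) (X : SchemeOver ℂ) (hX : IsSmoothProjective (2 * n) X), 1 ≤ n →
      ∃ P : complexBetti X (2 * n) →ₗ[ℂ] complexBetti X (2 * n),
        (∀ c : complexBetti X (2 * n), IsRationalClass c → IsOfHodgeType (2 * n) X (2 * n) n n c →
          P c = c) ∧
        (∀ b : complexBetti X (2 * n),
          (∀ a : complexBetti X (2 * n), IsRationalClass a → IsOfHodgeType (2 * n) X (2 * n) n n a →
            cupProduct (rfl : 2 * n + 2 * n = 2 * n + 2 * n) a b = 0) →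
          P b = 0)

/-- The statement of `stub_gramKunnethClass`, verbatim. -/
abbrev stub_gramKunnethClass : Prop :=
    ∀ (n : ℕ) (X : SchemeOver ℂ) (hX : IsSmoothProjective (2 * n) X), 1 ≤ n →
      ∀ P : complexBetti X (2 * n) →ₗ[ℂ] complexBetti X (2 * n),
        (∀ c : complexBetti X (2 * n), IsRationalClass c → IsOfHodgeType (2 * n) X (2 * n) n n c →
          P c = c) →
        (∀ b : complexBetti X (2 * n),
          (∀ a : complexBetti X (2 * n), IsRationalClass a → IsOfHodgeType (2 * n) X (2 * n) n n a →
            cupProduct (rfl : 2 * n + 2 * n = 2 * n + 2 * n) a b = 0) →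
          P b = 0) →
        ∃ π₀ : complexBetti (X ⊗ X) (2 * (2 * n)),
          π₀ ∈ Submodule.span ℂ {v : complexBetti (X ⊗ X) (2 * (2 * n)) |
            ∃ a b : complexBetti X (2 * n), IsRationalClass a ∧ IsOfHodgeType (2 * n) X (2 * n) n n a ∧
              IsRationalClass b ∧ IsOfHodgeType (2 * n) X (2 * n) n n b ∧
              v = cupProduct (two_mul (2 * n)).symm (complexBetti.map (fst X X) (2 * n) a)
                (complexBetti.map (snd X X) (2 * n) b)} ∧
          IsRationalClass π₀ ∧
          IsOfHodgeType (2 * n + 2 * n) (X ⊗ X) (2 * (2 * n)) (2 * n) (2 * n) π₀ ∧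
          ∃ t : ℂ, t ≠ 0 ∧
            corrAction complexOrientationFamily hX hX
              (rfl : 2 * n + 2 * (2 * n) = 2 * n + 2 * (2 * n)) π₀ = t • P

/-- The statement of `stub_gramClassAlgebraic`, verbatim. -/
abbrev stub_gramClassAlgebraic : Prop :=
    ∀ (n : ℕ) (X : SchemeOver ℂ) (hX : IsSmoothProjective (2 * n) X), 1 ≤ n →
      ∀ (π₀ : complexBetti (X ⊗ X) (2 * (2 * n))) (t : ℂ), t ≠ 0 →
        π₀ ∈ Submodule.span ℂ {v : complexBetti (X ⊗ X) (2 * (2 * n)) |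
            ∃ a b : complexBetti X (2 * n), IsRationalClass a ∧ IsOfHodgeType (2 * n) X (2 * n) n n a ∧
              IsRationalClass b ∧ IsOfHodgeType (2 * n) X (2 * n) n n b ∧
              v = cupProduct (two_mul (2 * n)).symm (complexBetti.map (fst X X) (2 * n) a)
                (complexBetti.map (snd X X) (2 * n) b)} →
        IsRationalClass π₀ →
        IsOfHodgeType (2 * n + 2 * n) (X ⊗ X) (2 * (2 * n)) (2 * n) (2 * n) π₀ →
        (∀ c : complexBetti X (2 * n), IsRationalClass c → IsOfHodgeType (2 * n) X (2 * n) n n c →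
          corrAction complexOrientationFamily hX hX
            (rfl : 2 * n + 2 * (2 * n) = 2 * n + 2 * (2 * n)) π₀ c = t • c) →
        (∀ b : complexBetti X (2 * n),
          (∀ a : complexBetti X (2 * n), IsRationalClass a → IsOfHodgeType (2 * n) X (2 * n) n n a →
            cupProduct (rfl : 2 * n + 2 * n = 2 * n + 2 * n) a b = 0) →
          corrAction complexOrientationFamily hX hX
            (rfl : 2 * n + 2 * (2 * n) = 2 * n + 2 * (2 * n)) π₀ b = 0) →
        π₀ ∈ algebraicClasses (X ⊗ X) (2 * n)

end Sig

/-- **Stub 1 — the orthogonal Hodge projector exists (theorem-grade; Hodge–Riemann).** For `X`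
smooth projective of dimension `2n ≥ 2` there is a `ℂ`-linear endomorphism `P` of
`H^{2n}(X(ℂ); ℂ)` which is the identity on every rational `(n,n)`-class and kills every class
cup-orthogonal to all rational `(n,n)`-classes — equivalently `H^{2n} = V ⊕ V^⊥` for
`V = ℂ · Hdgⁿ(X)`, i.e. the cup pairing is non-degenerate on `V`: every non-zero rational
`(n,n)`-class has a rational `(n,n)` partner (BFNP (6.1), in the tree from
`hardLefschetz_hodgeRiemann_holds` via `hardLefschetz_hodgeRiemann.hodgeClasses_cupPairing_nondegenerate`),
and `ℚ`-independent rational classes are `ℂ`-independent (`linearIndependent_of_isRationalClass`),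
so the rational Gram matrix of a `ℚ`-basis of `Hdgⁿ(X)` is invertible and
`P = Σ g^{kj} ⟨· ∪ a_j, [X]⟩ a_k`. [cite: BrosnanFangNiePearlstein2009, §6 display (6.1)]
[cite: VoisinHodgeI2002, §7.1.2 (i)–(ii), Thm. 6.32 and proof of Lemma 7.26] -/
theorem stub_orthogonalHodgeProjector :
    ∀ (n : ℕ) (X : SchemeOver ℂ) (hX : IsSmoothProjective (2 * n) X), 1 ≤ n →
      ∃ P : complexBetti X (2 * n) →ₗ[ℂ] complexBetti X (2 * n),
        (∀ c : complexBetti X (2 * n), IsRationalClass c → IsOfHodgeType (2 * n) X (2 * n) n n c →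
          P c = c) ∧
        (∀ b : complexBetti X (2 * n),
          (∀ a : complexBetti X (2 * n), IsRationalClass a → IsOfHodgeType (2 * n) X (2 * n) n n a →
            cupProduct (rfl : 2 * n + 2 * n = 2 * n + 2 * n) a b = 0) →
          P b = 0) := by
  sorry

/-- **Stub 2 — the Gram–Künneth class of the projector (theorem-grade; Voisin I Lemma 11.41 made
explicit).** For `X` smooth projective of dimension `2n ≥ 2` and ANY `ℂ`-linear `P` on
`H^{2n}(X(ℂ); ℂ)` that is the identity on the rational `(n,n)`-classes and zero on their
cup-orthogonal (such a `P` is unique: `V ⊕ V^⊥ = H^{2n}`), there is a RATIONAL class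
`π₀ ∈ H^{4n}((X ⊗ X)(ℂ); ℂ)` of Hodge type `(2n, 2n)`, lying in the `ℂ`-span of the exterior products
`pr₁^* a ∪ pr₂^* b` of rational `(n,n)`-classes `a, b` of `X`, whose correspondence action
`c ↦ pr₁_*(pr₂^* c ∪ π₀)` (`corrAction complexOrientationFamily`) is `t • P` for some `t ≠ 0`:
`π₀ = Σ_{k,j} g^{kj} pr₁^* a_k ∪ pr₂^* a_j` for a `ℚ`-basis `(a_k)` of `Hdgⁿ(X)` and the inverse
`(g^{kj})` of its rational Gram matrix; `π₀_*(u) = ± λ Σ g^{kj} ⟨u ∪ a_j, [X(ℂ)]_μ⟩ a_k`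
(projection formula, `corrAction_sum_cross_apply`), `t = ± λ c` the orientation scalar
(`exists_rational_dual`; it cannot be removed for rational `π₀`,
`corrAction_eq_smul_of_orientationFamily`); rationality by `IsRationalClass.map/.cup`,
`isRationalClass_sum`; Hodge type by `isOfHodgeType_cupProduct_map_map_of_multiplicative_deRham`.
[cite: VoisinHodgeI2002, §11.3.3 Thm. 11.38 and Lemma 11.41 with (11.11)]
[cite: HatcherAT2002, §3.3 Prop. 3.38] -/
theorem stub_gramKunnethClass :
    ∀ (n : ℕ) (X : SchemeOver ℂ) (hX : IsSmoothProjective (2 * n) X), 1 ≤ n →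
      ∀ P : complexBetti X (2 * n) →ₗ[ℂ] complexBetti X (2 * n),
        (∀ c : complexBetti X (2 * n), IsRationalClass c → IsOfHodgeType (2 * n) X (2 * n) n n c →
          P c = c) →
        (∀ b : complexBetti X (2 * n),
          (∀ a : complexBetti X (2 * n), IsRationalClass a → IsOfHodgeType (2 * n) X (2 * n) n n a →
            cupProduct (rfl : 2 * n + 2 * n = 2 * n + 2 * n) a b = 0) →
          P b = 0) →
        ∃ π₀ : complexBetti (X ⊗ X) (2 * (2 * n)),
          π₀ ∈ Submodule.span ℂ {v : complexBetti (X ⊗ X) (2 * (2 * n)) |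
            ∃ a b : complexBetti X (2 * n), IsRationalClass a ∧ IsOfHodgeType (2 * n) X (2 * n) n n a ∧
              IsRationalClass b ∧ IsOfHodgeType (2 * n) X (2 * n) n n b ∧
              v = cupProduct (two_mul (2 * n)).symm (complexBetti.map (fst X X) (2 * n) a)
                (complexBetti.map (snd X X) (2 * n) b)} ∧
          IsRationalClass π₀ ∧
          IsOfHodgeType (2 * n + 2 * n) (X ⊗ X) (2 * (2 * n)) (2 * n) (2 * n) π₀ ∧
          ∃ t : ℂ, t ≠ 0 ∧
            corrAction complexOrientationFamily hX hX
              (rfl : 2 * n + 2 * (2 * n) = 2 * n + 2 * (2 * n)) π₀ = t • P := by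
  sorry

/-- **Stub 3 — the Gram–Künneth class of the Hodge projector is algebraic (THE CRUX CONTENT,
open).** For `X` smooth projective of dimension `2n ≥ 2`: a rational class
`π₀ ∈ H^{4n}((X ⊗ X)(ℂ); ℂ)` of Hodge type `(2n, 2n)`, lying in the span of the exterior products of
rational `(n,n)`-classes of `X`, whose correspondence action is `t •` the identity on the rational
`(n,n)`-classes and zero on their cup-orthogonal (`t ≠ 0`), lies in
`algebraicClasses (X ⊗ X) (2n) = N^{2n}H^{4n}` — the Hodge conjecture for this one Hodge class
`[P] ∈ End_HS(H^{2n}(X, ℚ)) ⊂ Hdg^{2n}(X × X)`. Implied by HC(`X`) in degree `2n` (exterior products of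
algebraic classes are algebraic, `cupProduct_map_fst_map_snd_mem_supportedClasses`), hence a theorem
for `n = 1` (`lefschetzOneOne_rational_holds`; Kahn–Murre–Pedrini `π₂^{alg} = Σ g^{ij}[D_i × D_j]`)
and wherever End/Lefschetz correspondences span `Hdgⁿ` (abelian varieties of Weil type: the Weil
eigenprojectors are polynomials in graph correspondences; divisorial sectors); open in general.
[cite: VoisinHodgeI2002, §11.3.3 Lemma 11.41 and Conj. 11.24] [cite: Kleiman1968, §2]
[cite: Markman2025, arXiv:2502.03415 Thm. 1.1] -/
theorem stub_gramClassAlgebraic :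
    ∀ (n : ℕ) (X : SchemeOver ℂ) (hX : IsSmoothProjective (2 * n) X), 1 ≤ n →
      ∀ (π₀ : complexBetti (X ⊗ X) (2 * (2 * n))) (t : ℂ), t ≠ 0 →
        π₀ ∈ Submodule.span ℂ {v : complexBetti (X ⊗ X) (2 * (2 * n)) |
            ∃ a b : complexBetti X (2 * n), IsRationalClass a ∧ IsOfHodgeType (2 * n) X (2 * n) n n a ∧
              IsRationalClass b ∧ IsOfHodgeType (2 * n) X (2 * n) n n b ∧
              v = cupProduct (two_mul (2 * n)).symm (complexBetti.map (fst X X) (2 * n) a)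
                (complexBetti.map (snd X X) (2 * n) b)} →
        IsRationalClass π₀ →
        IsOfHodgeType (2 * n + 2 * n) (X ⊗ X) (2 * (2 * n)) (2 * n) (2 * n) π₀ →
        (∀ c : complexBetti X (2 * n), IsRationalClass c → IsOfHodgeType (2 * n) X (2 * n) n n c →
          corrAction complexOrientationFamily hX hX
            (rfl : 2 * n + 2 * (2 * n) = 2 * n + 2 * (2 * n)) π₀ c = t • c) →
        (∀ b : complexBetti X (2 * n),
          (∀ a : complexBetti X (2 * n), IsRationalClass a → IsOfHodgeType (2 * n) X (2 * n) n n a →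
            cupProduct (rfl : 2 * n + 2 * n = 2 * n + 2 * n) a b = 0) →
          corrAction complexOrientationFamily hX hX
            (rfl : 2 * n + 2 * (2 * n) = 2 * n + 2 * (2 * n)) π₀ b = 0) →
        π₀ ∈ algebraicClasses (X ⊗ X) (2 * n) := by
  sorry

/-- **Assembly (kernel-checked, no `sorry`): the three stub STATEMENTS (`Sig.stub_*`, verbatim) imply
the crux `HodgeProjectorAlgebraic` by name.** Take the orthogonal Hodge projector `P` (stub 1), its
Gram–Künneth class `π₀` with `π₀_* = t • P`, `t ≠ 0` (stub 2) — so `π₀_*` is `t •` the identity on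
`Hdgⁿ` and zero on `Hdgⁿ^⊥` —, algebraic by stub 3; then `π := t⁻¹ • π₀` is algebraic (`N^{2n}H^{4n}`
is a `ℂ`-submodule) and `π_* = t⁻¹ • π₀_*` is the identity on `Hdgⁿ` and zero on `Hdgⁿ^⊥`.
[cite: VoisinHodgeI2002, §11.3.3 Lemma 11.41] -/
theorem HodgeProjectorAlgebraic_of :
    Sig.stub_orthogonalHodgeProjector → Sig.stub_gramKunnethClass → Sig.stub_gramClassAlgebraic →
      Summit.HodgeConjecture.HodgeConjecture.Theses.HodgeProjectorDivisorSupport.HodgeProjectorAlgebraic := by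
  intro h₁ h₂ h₃ n X hX hn
  obtain ⟨P, hPid, hPker⟩ := h₁ n X hX hn
  obtain ⟨π₀, hspan, hrat, hhdg, t, ht, hact⟩ := h₂ n X hX hn P hPid hPker
  -- the action of `π₀`: `t •` identity on the rational `(n,n)`-classes, zero on their orthogonal
  have hid : ∀ c : complexBetti X (2 * n), IsRationalClass c →
      IsOfHodgeType (2 * n) X (2 * n) n n c →
        corrAction complexOrientationFamily hX hX
          (rfl : 2 * n + 2 * (2 * n) = 2 * n + 2 * (2 * n)) π₀ c = t • c := by
    intro c hc hh
    rw [hact, LinearMap.smul_apply, hPid c hc hh]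
  have hker : ∀ b : complexBetti X (2 * n),
      (∀ a : complexBetti X (2 * n), IsRationalClass a → IsOfHodgeType (2 * n) X (2 * n) n n a →
        cupProduct (rfl : 2 * n + 2 * n = 2 * n + 2 * n) a b = 0) →
        corrAction complexOrientationFamily hX hX
          (rfl : 2 * n + 2 * (2 * n) = 2 * n + 2 * (2 * n)) π₀ b = 0 := by
    intro b hb
    rw [hact, LinearMap.smul_apply, hPker b hb, smul_zero]
  -- stub 3: `π₀` is algebraic; rescale by `t⁻¹`
  have halg : π₀ ∈ algebraicClasses (X ⊗ X) (2 * n) :=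
    h₃ n X hX hn π₀ t ht hspan hrat hhdg hid hker
  refine ⟨t⁻¹ • π₀, Submodule.smul_mem _ _ halg, ?_, ?_⟩
  · intro c hc hh
    rw [map_smul, LinearMap.smul_apply, hid c hc hh, smul_smul, inv_mul_cancel₀ ht, one_smul]
  · intro b hb
    rw [map_smul, LinearMap.smul_apply, hker b hb, smul_zero]

/-- **Registered target of the skeleton — the crux BY NAME with NO hypotheses**:
`HodgeProjectorAlgebraic_of` instantiated with the three declared stubs. NOT a proof of the crux: its
axioms contain `sorryAx`, exactly through `stub_orthogonalHodgeProjector`, `stub_gramKunnethClass`,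
`stub_gramClassAlgebraic` (the only declarations of this file that use `sorry`). -/
theorem HodgeProjectorAlgebraic_of_stubs :
    Summit.HodgeConjecture.HodgeConjecture.Theses.HodgeProjectorDivisorSupport.HodgeProjectorAlgebraic :=
  HodgeProjectorAlgebraic_of stub_orthogonalHodgeProjector stub_gramKunnethClass stub_gramClassAlgebraic

end Summit.HodgeConjecture.HodgeConjecture.Cruxes.HodgeProjectorAlgebraic.Birth

end
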